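import Literature.AlgebraicGeometry.Motives.FormDivisorGenericFibre
import Literature.AlgebraicGeometry.Motives.OsculatingLineMultiplicity
import HarnessLib

/-!
# The intersection cycle of a family of osculating lines with the cubic: `3 [section] + verticals`

R. Mboro, *Remarks on the `CH₂` of cubic hypersurfaces* (arXiv:1701.04488), proof of Thm. 1.2,
Case 2 (p. 7): for the family `P = Σ ×_{F(X)} 𝒫 → Σ` of osculating lines over a surface `Σ` and
its map `q : P → ℙⁿ⁺¹`, "`q^*X = d σ(Σ) + D'`, where `D'` is supported over a proper closed subset
of `Σ`" — the section `σ(Σ)` (the points of contact) enters with multiplicity `d = 3` because the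
general osculating line is not in `X` and meets it at `x` with multiplicity `d` (Lemma 1.1).

This file proves the cycle-level statement behind this sentence, for the family of lines over an
arbitrary integral base `B` (locally of finite type over an infinite field `k`, function field
`K = k(B)`) given by its generic line, the `K`-line `l = V₊(μ)` through `[x], [y] ∈ ℙᴺ(K)`, when
`l` osculates the cubic `V₊(F)` at `[x]` (`F(s x + t y) = t³ F(y)`) and is not on it (`F(y) ≠ 0`).
The total space of the family is the closure of `ι(l)` in `ℙᴺ ×ₖ B` (`ι : ℙᴺ_K → ℙᴺ ×ₖ B` the
generic fibre), and `q^*X` is Fulton's intersection cycle `pr₁^*V₊(F) · [closure ι(l)]`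
(`CartierDivisor.primeInter`, `Motives/CartierDivisorIntersectionCycle`;
`ProjFamily.pullbackFormDivisor`, `Motives/FormDivisorGenericFibre`):

* `ProjFamily.exists_primeInter_pullbackFormDivisor_eq_smul_add` — the general statement for a form `G` of degree `e ≥ 1` with `V₊(G ⊗ 1) · [l] = m [x]` on `ℙᴺ_K`;
* `ProjFamily.exists_primeInter_pullbackFormDivisor_line_eq` — **`pr₁^*V₊(F) · [closure ι(l)] =
  3 [closure ι([x])] + V` with `V ≥ 0` supported on points `w` of dimension `dim B` lying over a
  proper closed subset of `B` (`pr₂ w ≠ η_B`), in the closure of `ι(l)`, and on `pr₁⁻¹ V₊(F)`;**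
* `ProjFamily.exists_primeInter_pullbackFormDivisor_line_eq_of_linear` — the same for a hyperplane
  `V₊(ν) ∌ l` through `[x]`, with multiplicity `1` (the hyperplane section of the swept threefold in
  Case 1 of Mboro's proof).

Proof: the points of `ℙᴺ ×ₖ B` over `η_B` are those of the generic fibre (`range_genericFibreι`),
where the coefficients are those of `V₊(F ⊗ 1) · [l]` on `ℙᴺ_K`
(`primeInter_pullbackFormDivisor_genericFibreι`), which is `3 [[x]]`
(`ProjSpace.primeInter_formDivisor_line_eq_three_smul`, `Motives/OsculatingLineMultiplicity`).

Everything is proved; no named facts.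

## References

* [Mboro2018] R. Mboro, Remarks on the CH₂ of cubic hypersurfaces, arXiv:1701.04488, Lemma 1.1
  and proof of Thm. 1.2, Case 2 (p. 7).
* [Fulton1998] W. Fulton, Intersection Theory, 2nd ed. (1998), Def. 2.3, Thm. 2.4.
-/

noncomputable section

open CategoryTheory CategoryTheory.Limits AlgebraicGeometry Order MonoidalCategory Topology
  TopologicalSpace
open MvPolynomial (eval)
open Literature.AlgebraicGeometry.Motives.Segre Literature.AlgebraicGeometry.Motives.RatFn

universe u

namespace Literature.AlgebraicGeometry.Motives

attribute [local instance] MvPolynomial.gradedAlgebra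

namespace ProjFamily

open ProjBaseChangeRing ProjSpace ProjectiveSpace

variable {k : Type u} [Field k] (N : ℕ) (B : SchemeOver k) [IsIntegral B.left]

/-! ### Points of `ℙᴺ ×ₖ B` over the generic point of `B` -/

/-- `pr₂ (ι p) = η_B`. [folklore] -/
theorem snd_genericFibreι_apply (p : ↥(projectiveSpace N B.left.functionField).left) :
    (CartesianMonoidalCategory.snd (projectiveSpace N k) B).left (genericFibreι N B p) =
      genericPoint B.left := by
  have h : genericFibreι N B p ∈ Set.range (genericFibreι N B).base := ⟨p, rfl⟩
  rw [range_genericFibreι] at h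
  exact h

/-- `ι z ⤳ ι q ↔ z ⤳ q` (the generic fibre is an embedding). [folklore] -/
theorem genericFibreι_specializes_iff (z q : ↥(projectiveSpace N B.left.functionField).left) :
    genericFibreι N B z ⤳ genericFibreι N B q ↔ z ⤳ q :=
  (genericFibreι N B).isEmbedding.isInducing.specializes_iff

/-- **A point over `η_B` in the closure of `ι z` is `ι q` for a specialisation `q` of `z`.**
[folklore] -/
theorem exists_eq_genericFibreι_of_specializes {z : ↥(projectiveSpace N B.left.functionField).left}
    {w : ↥((projectiveSpace N k) ⊗ B).left} (hzw : genericFibreι N B z ⤳ w)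
    (hw : (CartesianMonoidalCategory.snd (projectiveSpace N k) B).left w = genericPoint B.left) :
    ∃ q, w = genericFibreι N B q ∧ z ⤳ q := by
  have hw' : w ∈ Set.range (genericFibreι N B).base := by
    rw [range_genericFibreι]; exact hw
  obtain ⟨q, rfl⟩ := hw'
  exact ⟨q, rfl, (genericFibreι_specializes_iff N B z q).1 hzw⟩

/-! ### The decomposition `pr₁^*V₊(G) · [closure ι(l)] = m [closure ι(x)] + V` -/

variable {N B} [LocallyOfFiniteType B.hom]

/-- **Horizontal part on the generic fibre, vertical part over a proper closed subset.** For a form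
`G` over `k` of degree `e ≥ 1`, the `K`-line `l = V₊(μ)` of `ℙᴺ_K` (`K = k(B)`) not on `V₊(G ⊗ 1)`,
and a closed point `x` of `l` with `V₊(G ⊗ 1) · [l] = m [x]` on `ℙᴺ_K`: the intersection cycle
`pr₁^*V₊(G) · [closure ι(l)]` on `ℙᴺ ×ₖ B` is `m [closure ι(x)] + V` with `V` effective and
supported on points `w` with `ι(l) ⤳ w`, `dim w = dim B`, `pr₂ w ≠ η_B` and `G ∈ 𝔭_{pr₁ w}` (the
points over `η_B` are those of the generic fibre, where the coefficients are computed on `ℙᴺ_K`,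
`primeInter_pullbackFormDivisor_genericFibreι`). [cite: Fulton1998, Def. 2.3 and Thm. 2.4] [cite: Mboro2018, proof of Thm. 1.2, Case 2 (arXiv:1701.04488, p. 7)] -/
theorem exists_primeInter_pullbackFormDivisor_eq_smul_add (hN : 1 ≤ N) {b : ℕ}
    (hb : height (genericPoint B.left) = b) {e : ℕ} (he : 0 < e)
    {G : MvPolynomial (Fin (N + 1)) k} (hG : G ∈ grading (Fin (N + 1)) k e) (hG0 : G ≠ 0)
    {μ : Fin (N - 1) → MvPolynomial (Fin (N + 1)) B.left.functionField}
    (hμli : LinearIndependent B.left.functionField μ) (hμhom : ∀ l, (μ l).IsHomogeneous 1)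
    (hGlam : MvPolynomial.map (algebraMap k B.left.functionField) G ∉
      ProjectiveSpectrum.asHomogeneousIdeal
        (𝒜 := MvPolynomial.homogeneousSubmodule (Fin (N + 1)) B.left.functionField)
        (linearSubspacePoint μ hμli hμhom (Nat.sub_le N 1)))
    {xP : ↥(projectiveSpace N B.left.functionField).left}
    (hlamxP : linearSubspacePoint μ hμli hμhom (Nat.sub_le N 1) ⤳ xP) (hxP0 : height xP = 0) {m : ℕ}
    (hK : ∀ (hGK : MvPolynomial.map (algebraMap k B.left.functionField) G ∈
        grading (Fin (N + 1)) B.left.functionField e) (hGK0),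
        (formDivisor (MvPolynomial.map (algebraMap k B.left.functionField) G) hGK
          hGK0).primeInter (X := projectiveSpace N B.left.functionField)
            (linearSubspacePoint μ hμli hμhom (Nat.sub_le N 1)) = m • primeCycle xP) :
    ∃ V : AlgebraicCycle ((projectiveSpace N k) ⊗ B).left ℤ,
      (pullbackFormDivisor (B := B) hG hG0).primeInter (X := (projectiveSpace N k) ⊗ B)
          (genericFibreι N B (linearSubspacePoint μ hμli hμhom (Nat.sub_le N 1))) =
        m • primeCycle (genericFibreι N B xP) + V ∧
      (∀ w, 0 ≤ V w) ∧
      ∀ w, V w ≠ 0 →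
        genericFibreι N B (linearSubspacePoint μ hμli hμhom (Nat.sub_le N 1)) ⤳ w ∧
        height w = b ∧
        (CartesianMonoidalCategory.snd (projectiveSpace N k) B).left w ≠ genericPoint B.left ∧
        G ∈ ProjectiveSpectrum.asHomogeneousIdeal
          (𝒜 := MvPolynomial.homogeneousSubmodule (Fin (N + 1)) k)
          ((CartesianMonoidalCategory.fst (projectiveSpace N k) B).left w) := by
  classical
  -- notation
  let ι := genericFibreι N B
  let lam : ↥(projectiveSpace N B.left.functionField).left :=
    linearSubspacePoint μ hμli hμhom (Nat.sub_le N 1)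
  have hι_inj : Function.Injective ι.base := ι.isEmbedding.injective
  have havs : (pullbackFormDivisor (B := B) hG hG0).Avoids (ι lam) :=
    (pullbackFormDivisor_avoids_genericFibreι_iff hG hG0 he lam).2 hGlam
  -- heights
  have hlam1 : height lam = 1 := height_linearSubspacePoint_of_line hN μ hμli hμhom
  have hιlam : height (ι lam) = b + 1 := by
    change height (genericFibreι N B lam) = _
    rw [height_genericFibreι_apply N B hb, hlam1]
  have hxPlam : xP ≠ lam := by
    intro h
    have h' := hxP0
    rw [h, hlam1] at h'
    exact one_ne_zero h'
  -- the coefficients over `η_B`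
  have hhor : ∀ w, ι lam ⤳ w →
      (CartesianMonoidalCategory.snd (projectiveSpace N k) B).left w = genericPoint B.left →
      (pullbackFormDivisor (B := B) hG hG0).primeInter (X := (projectiveSpace N k) ⊗ B) (ι lam) w =
        (m • primeCycle (ι xP)) w := by
    intro w hw hwη
    obtain ⟨q, rfl, hlamq⟩ := exists_eq_genericFibreι_of_specializes N B hw hwη
    change _ = (m • primeCycle (ι xP)) (ι q)
    rw [Function.locallyFinsuppWithin.coe_nsmul, Pi.smul_apply,
      primeCycle_apply_of_injective' hι_inj]
    by_cases hq : q = lam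
    · subst hq
      rw [CartierDivisor.primeInter_apply_eq_zero_of_avoids _ _ havs,
        primeCycle_apply_of_ne hxPlam.symm, nsmul_zero]
    · have hqz : q ∈ ProjectiveSpectrum.zeroLocus
          (MvPolynomial.homogeneousSubmodule (Fin (N + 1)) B.left.functionField) (Set.range μ) := by
        rw [← closure_linearSubspacePoint μ hμli hμhom (Nat.sub_le N 1)]
        exact specializes_iff_mem_closure.mp hlamq
      have hq0 : height q = 0 := height_eq_zero_of_mem_line hN μ hμli hμhom hqz hq
      have hcodim : height q + 1 = height lam := by rw [hq0, hlam1, zero_add]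
      change (pullbackFormDivisor (B := B) hG hG0).primeInter (X := (projectiveSpace N k) ⊗ B)
        (genericFibreι N B lam) (genericFibreι N B q) = _
      rw [primeInter_pullbackFormDivisor_genericFibreι hG hG0 he hlamq hcodim hGlam, hK,
        Function.locallyFinsuppWithin.coe_nsmul, Pi.smul_apply]
  -- the decomposition
  refine ⟨(pullbackFormDivisor (B := B) hG hG0).primeInter (X := (projectiveSpace N k) ⊗ B) (ι lam) -
    m • primeCycle (ι xP), (add_sub_cancel _ _).symm, fun w => ?_, fun w hw => ?_⟩
  · -- effectivity
    simp only [Function.locallyFinsuppWithin.coe_sub, Pi.sub_apply]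
    by_cases hwx : w = ι xP
    · subst hwx
      have h := hhor (ι xP) ((genericFibreι_specializes_iff N B lam xP).2 hlamxP)
        (snd_genericFibreι_apply N B xP)
      rw [h, sub_self]
    · rw [Function.locallyFinsuppWithin.coe_nsmul, Pi.smul_apply, primeCycle_apply_of_ne hwx,
        nsmul_zero, sub_zero]
      exact CartierDivisor.primeInter_nonneg
        ((isEffective_formDivisor hG hG0).pullbackAvoiding _ _) havs w
  · -- support
    have hwx : w ≠ ι xP := by
      rintro rfl
      apply hw
      simp only [Function.locallyFinsuppWithin.coe_sub, Pi.sub_apply]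
      rw [hhor (ι xP) ((genericFibreι_specializes_iff N B lam xP).2 hlamxP)
        (snd_genericFibreι_apply N B xP), sub_self]
    have hZw : (pullbackFormDivisor (B := B) hG hG0).primeInter (X := (projectiveSpace N k) ⊗ B)
        (ι lam) w ≠ 0 := by
      intro h0
      apply hw
      simp only [Function.locallyFinsuppWithin.coe_sub, Pi.sub_apply]
      rw [h0, Function.locallyFinsuppWithin.coe_nsmul, Pi.smul_apply, primeCycle_apply_of_ne hwx,
        nsmul_zero, sub_zero]
    have hsp : ι lam ⤳ w := CartierDivisor.specializes_of_primeInter_ne_zero _ hZw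
    refine ⟨hsp, ?_, fun hwη => hw ?_, ?_⟩
    · exact CartierDivisor.primeInter_mem_cyclesOfDim (X := (projectiveSpace N k) ⊗ B)
        (pullbackFormDivisor (B := B) hG hG0) (z := ι lam) (d := b) hιlam w hZw
    · simp only [Function.locallyFinsuppWithin.coe_sub, Pi.sub_apply]
      rw [hhor w hsp hwη, sub_self]
    · have hnav := CartierDivisor.not_avoids_of_primeInter_ne_zero _ hZw
      rw [pullbackFormDivisor_avoids_iff hG hG0 he] at hnav
      exact not_not.mp hnav

/-! ### The cubic and an osculating line: `pr₁^*V₊(F) · [closure ι(l)] = 3 [closure ι([x])] + V` -/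

variable [Infinite k]

/-- **`q^*X = 3 σ(Σ) + D'` with `D'` over a proper closed subset of the base** (Mboro,
arXiv:1701.04488, proof of Thm. 1.2, Case 2, p. 7), for the family of lines over an integral base
`B` with generic line the `K`-line `l = V₊(μ)` through `[x], [y]` osculating the cubic `V₊(F)` at
`[x]` (`F(s x + t y) = t³ F(y)`) and not on it (`F(y) ≠ 0`): the intersection cycle
`pr₁^*V₊(F) · [closure ι(l)]` on `ℙᴺ ×ₖ B` is `3 [closure ι([x])] + V` with `V` effective and
supported on points `w` with `ι(l) ⤳ w`, `dim w = dim B`, `pr₂ w ≠ η_B` and `F ∈ 𝔭_{pr₁ w}`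
(`ProjSpace.primeInter_formDivisor_line_eq_three_smul` on the generic fibre).
[cite: Mboro2018, Lemma 1.1 (p. 6) and proof of Thm. 1.2, Case 2 (arXiv:1701.04488, p. 7)] [cite: Fulton1998, Def. 2.3 and Thm. 2.4] -/
theorem exists_primeInter_pullbackFormDivisor_line_eq (hN : 1 ≤ N) {b : ℕ}
    (hb : height (genericPoint B.left) = b)
    {x y : Fin (N + 1) → B.left.functionField}
    (hxy : LinearIndependent B.left.functionField ![x, y])
    {F : MvPolynomial (Fin (N + 1)) k} (hF : F ∈ grading (Fin (N + 1)) k 3) (hF0 : F ≠ 0)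
    (hosc : ∀ s t : B.left.functionField,
      eval (s • x + t • y) (MvPolynomial.map (algebraMap k B.left.functionField) F) =
        t ^ 3 * eval y (MvPolynomial.map (algebraMap k B.left.functionField) F))
    (hFy : eval y (MvPolynomial.map (algebraMap k B.left.functionField) F) ≠ 0)
    {μ : Fin (N - 1) → MvPolynomial (Fin (N + 1)) B.left.functionField}
    (hμli : LinearIndependent B.left.functionField μ) (hμhom : ∀ l, (μ l).IsHomogeneous 1)
    (hμx : ∀ l, eval x (μ l) = 0) (hμy : ∀ l, eval y (μ l) = 0)
    (hμideal : ∀ G : MvPolynomial (Fin (N + 1)) B.left.functionField,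
      (∀ s t : B.left.functionField, eval (s • x + t • y) G = 0) → G ∈ Ideal.span (Set.range μ)) :
    ∃ V : AlgebraicCycle ((projectiveSpace N k) ⊗ B).left ℤ,
      (pullbackFormDivisor (B := B) hF hF0).primeInter (X := (projectiveSpace N k) ⊗ B)
          (genericFibreι N B (linearSubspacePoint μ hμli hμhom (Nat.sub_le N 1))) =
        3 • primeCycle (genericFibreι N B
          (pointOfVec B.left.functionField x (by simpa using hxy.ne_zero 0)).pt) + V ∧
      (∀ w, 0 ≤ V w) ∧
      ∀ w, V w ≠ 0 →
        genericFibreι N B (linearSubspacePoint μ hμli hμhom (Nat.sub_le N 1)) ⤳ w ∧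
        height w = b ∧
        (CartesianMonoidalCategory.snd (projectiveSpace N k) B).left w ≠ genericPoint B.left ∧
        F ∈ ProjectiveSpectrum.asHomogeneousIdeal
          (𝒜 := MvPolynomial.homogeneousSubmodule (Fin (N + 1)) k)
          ((CartesianMonoidalCategory.fst (projectiveSpace N k) B).left w) := by
  haveI : Infinite B.left.functionField :=
    Infinite.of_injective _ (algebraMap k B.left.functionField).injective
  have hx0 : x ≠ 0 := by simpa using hxy.ne_zero 0
  have hFlam : MvPolynomial.map (algebraMap k B.left.functionField) F ∉
      ProjectiveSpectrum.asHomogeneousIdeal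
        (𝒜 := MvPolynomial.homogeneousSubmodule (Fin (N + 1)) B.left.functionField)
        (linearSubspacePoint μ hμli hμhom (Nat.sub_le N 1)) :=
    notMem_asHomogeneousIdeal_linearSubspacePoint_of_eval_ne_zero hμli hμhom hμy hFy
  -- `[x]` is a closed point of the line
  have hxline : (pointOfVec B.left.functionField x hx0).pt ∈ ProjectiveSpectrum.zeroLocus
      (MvPolynomial.homogeneousSubmodule (Fin (N + 1)) B.left.functionField) (Set.range μ) := by
    rintro _ ⟨l, rfl⟩
    exact mem_asHomogeneousIdeal_pt_pointOfVec hx0 zero_lt_one (hμhom l) (hμx l)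
  have hlamxP : linearSubspacePoint μ hμli hμhom (Nat.sub_le N 1) ⤳
      (pointOfVec B.left.functionField x hx0).pt := by
    rw [specializes_iff_mem_closure, closure_linearSubspacePoint]
    exact hxline
  exact exists_primeInter_pullbackFormDivisor_eq_smul_add hN hb three_pos hF hF0 hμli hμhom hFlam
    hlamxP (height_pt _) fun hFK hFK0 =>
      primeInter_formDivisor_line_eq_three_smul hN hxy hFK hFK0 hosc hFy hμli hμhom hμx hμy hμideal

/-! ### A hyperplane through a point of the line: `pr₁^*V₊(ν) · [closure ι(l)] = [closure ι([x])] + V` -/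

omit [Infinite k] in
/-- **`pr₁^*V₊(ν) · [closure ι(l)] = [closure ι([x])] + V`** for a hyperplane `V₊(ν)` defined over
`k` through the `K`-point `[x]` of the `K`-line `l = [x][y]` and not containing it
(`ν(x) = 0 ≠ ν(y)`): horizontal part the section `closure ι([x])` with multiplicity ONE
(`ProjSpace.primeInter_formDivisor_linear_line_eq_primeCycle`, Fulton Example 2.5.1), vertical part
effective over a proper closed subset of `B`, on `pr₁⁻¹V₊(ν)` (Mboro, proof of Thm. 1.2, Case 1:
the hyperplane section `H_X · f_*(1)` of the threefold swept by the lines).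
[cite: Mboro2018, proof of Thm. 1.2, Case 1 (arXiv:1701.04488, p. 7)] [cite: Fulton1998, Example 2.5.1 (p. 41)] -/
theorem exists_primeInter_pullbackFormDivisor_line_eq_of_linear (hN : 1 ≤ N) {b : ℕ}
    (hb : height (genericPoint B.left) = b)
    {x y : Fin (N + 1) → B.left.functionField} (hx0 : x ≠ 0)
    {ν : MvPolynomial (Fin (N + 1)) k} (hν : ν ∈ grading (Fin (N + 1)) k 1) (hν0 : ν ≠ 0)
    (hνx : eval x (MvPolynomial.map (algebraMap k B.left.functionField) ν) = 0)
    (hνy : eval y (MvPolynomial.map (algebraMap k B.left.functionField) ν) ≠ 0)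
    {μ : Fin (N - 1) → MvPolynomial (Fin (N + 1)) B.left.functionField}
    (hμli : LinearIndependent B.left.functionField μ) (hμhom : ∀ l, (μ l).IsHomogeneous 1)
    (hμx : ∀ l, eval x (μ l) = 0) (hμy : ∀ l, eval y (μ l) = 0) :
    ∃ V : AlgebraicCycle ((projectiveSpace N k) ⊗ B).left ℤ,
      (pullbackFormDivisor (B := B) hν hν0).primeInter (X := (projectiveSpace N k) ⊗ B)
          (genericFibreι N B (linearSubspacePoint μ hμli hμhom (Nat.sub_le N 1))) =
        primeCycle (genericFibreι N B (pointOfVec B.left.functionField x hx0).pt) + V ∧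
      (∀ w, 0 ≤ V w) ∧
      ∀ w, V w ≠ 0 →
        genericFibreι N B (linearSubspacePoint μ hμli hμhom (Nat.sub_le N 1)) ⤳ w ∧
        height w = b ∧
        (CartesianMonoidalCategory.snd (projectiveSpace N k) B).left w ≠ genericPoint B.left ∧
        ν ∈ ProjectiveSpectrum.asHomogeneousIdeal
          (𝒜 := MvPolynomial.homogeneousSubmodule (Fin (N + 1)) k)
          ((CartesianMonoidalCategory.fst (projectiveSpace N k) B).left w) := by
  have hνlam : MvPolynomial.map (algebraMap k B.left.functionField) ν ∉
      ProjectiveSpectrum.asHomogeneousIdeal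
        (𝒜 := MvPolynomial.homogeneousSubmodule (Fin (N + 1)) B.left.functionField)
        (linearSubspacePoint μ hμli hμhom (Nat.sub_le N 1)) :=
    notMem_asHomogeneousIdeal_linearSubspacePoint_of_eval_ne_zero hμli hμhom hμy hνy
  have hxline : (pointOfVec B.left.functionField x hx0).pt ∈ ProjectiveSpectrum.zeroLocus
      (MvPolynomial.homogeneousSubmodule (Fin (N + 1)) B.left.functionField) (Set.range μ) := by
    rintro _ ⟨l, rfl⟩
    exact mem_asHomogeneousIdeal_pt_pointOfVec hx0 zero_lt_one (hμhom l) (hμx l)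
  have hlamxP : linearSubspacePoint μ hμli hμhom (Nat.sub_le N 1) ⤳
      (pointOfVec B.left.functionField x hx0).pt := by
    rw [specializes_iff_mem_closure, closure_linearSubspacePoint]
    exact hxline
  obtain ⟨V, hV⟩ := exists_primeInter_pullbackFormDivisor_eq_smul_add hN hb one_pos hν hν0 hμli hμhom
    hνlam hlamxP (height_pt _) (m := 1) fun hνK hνK0 => by
      rw [one_nsmul]
      exact primeInter_formDivisor_linear_line_eq_primeCycle hN hx0 hμli hμhom hμx hμy hνK hνK0 hνx hνy
  rw [one_nsmul] at hV
  exact ⟨V, hV⟩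

end ProjFamily

end Literature.AlgebraicGeometry.Motives
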